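import Literature.NumberTheory.LFunctions.DegreeOnePrimesDiscriminantBound
import Literature.NumberTheory.LFunctions.DegreeOnePrimes
import Mathlib.RingTheory.Adjoin.PowerBasis
import HarnessLib

/-!
# The exact Dedekind–Kummer count for `ℚ[X]/(g)` with `g` non-monic

Topic `Literature/NumberTheory/LFunctions`, grouping namespace `DegreeOnePrimes`; complement to
`DegreeOnePrimesDiscriminantBound.lean` (which proves the ONE-SIDED statement
`exists_root_mod_of_absNorm_eq`: an ideal of prime norm `p ∤ g_d` gives a root of `g` modulo `p`, all
that the lower bound of Bürgisser 2000 TCS Cor. 4.8 needs) and to `DegreeOnePrimes.lean` (the exact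
count `card_absNorm_eq_prime_eq_card_roots` for MONIC generators, at the primes not dividing
`RingOfIntegers.exponent`). Here: the exact count for a non-monic `g ∈ ℤ[Y]` irreducible over `ℚ`,
with an explicit exceptional set. Bürgisser, §4.2 p. 83: "there is a bijection between the
irreducible factors of `g` modulo `p` and the primes of the number field `K = ℚ[Y]/(g)` lying over
`p`, provided `p` is not a divisor of the discriminant `Δ` of `g` (cf. [20]). Under this bijection,
the roots of `g` modulo `p` correspond to the primes of degree one lying over `p`" ([20] = Marcus,
*Number Fields*, monic case). For non-monic `g` the primes `p ∣ g_d` must also be excluded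
(`g = 2Y² + Y + 1`, `Δ = −7`: `2` splits in `ℚ(√−7)` but `g` has one root modulo `2`), which makes
Theorem 4.7 as printed (two-sided, error in `Δ` alone) false for non-monic `g`; the correct
exceptional set used here is `{p : p ∣ g_d · D_g}` with `D_g = tailDiscr g`
(`DegreeOnePrimesTailOrder.lean`). We apply Mathlib's Dedekind–Kummer theorem to the algebraic
integer `θ = g_d y` (`scaledRoot g`, `DegreeOnePrimesDiscriminantBound.lean`), a root of the monic
`integralNormalization g`. Everything here is PROVED:

* `adjoin_scaledRoot_eq_top` (`ℚ(θ) = K_g`), `scaledRootPB` (the power basis of `θ`, `dim = d`),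
  `minpoly_scaledRoot : minpoly ℤ θ = integralNormalization g`;
* `discr_scaledRootPB : disc(1, θ, …, θ^{d-1}) = g_d^{d(d-1)} disc(1, y, …, y^{d-1})`;
* `exponent_dvd_natAbs_of_powerBasis` — for any `K = ℚ(α)`, `α ∈ 𝓞 K`, and `D ∈ ℤ` the
  discriminant of `(1, α, …, α^{d-1})`: `RingOfIntegers.exponent α ∣ |D|` (the discriminant lies in
  the conductor; quantitative form of `DegreeOnePrimes.exponent_pos_of_powerBasis`);
* `not_dvd_exponent_scaledRoot` — `p ∤ g_d D_g ⇒ p ∤ exponent θ`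
  (as `disc(1, θ, …) · g_d^{2d} = D_g · g_d^{d(d-1)}` in `ℤ`);
* `card_roots_toFinset_integralNormalization_map` — for `p ∤ g_d`, `z ↦ g_d z` matches the roots of
  `g` and of `integralNormalization g` modulo `p`;
* `idealNormCount_rootField_eq_card_roots` — **for `p ∤ g_d D_g`, the number of ideals of `𝓞 K_g`
  of norm `p` equals the number of roots of `g` modulo `p`.**

## References

* P. Bürgisser, *Cook's versus Valiant's hypothesis*, TCS 235 (2000), §4.2 p. 83 (`Burgisser2000TCS`).
* D. A. Marcus, *Number Fields*, Springer 1977, ch. 3 (Dedekind–Kummer, monic case), as cited by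
  Bürgisser; the non-monic bookkeeping is tagged folklore.
-/

noncomputable section

open Polynomial NumberField

namespace Literature.NumberTheory.LFunctions

namespace DegreeOnePrimes

section ScaledRoot

variable (g : ℤ[X]) [Fact (Irreducible (g.map (algebraMap ℤ ℚ)))]

/-- `(integralNormalization g)(θ) = 0`. [folklore] -/
theorem aeval_scaledRoot_integralNormalization :
    aeval (scaledRoot g : RootField g) (integralNormalization g) = 0 := by
  have h := integralNormalization_aeval_eq_zero (aeval_root_eq_zero g)
    (fun x hx => (algebraMap ℤ (RootField g)).injective_int (by rw [hx, map_zero]))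
  rwa [eq_intCast] at h

/-- `ℚ(θ) = K_g` (as `y = g_d⁻¹ θ`). [folklore] -/
theorem adjoin_scaledRoot_eq_top :
    Algebra.adjoin ℚ {(scaledRoot g : RootField g)} = ⊤ := by
  rw [eq_top_iff, show (⊤ : Subalgebra ℚ (RootField g)) =
      Algebra.adjoin ℚ {AdjoinRoot.root (g.map (algebraMap ℤ ℚ))} from
    AdjoinRoot.adjoinRoot_eq_top.symm, Algebra.adjoin_le_iff, Set.singleton_subset_iff,
    SetLike.mem_coe]
  have ha : (g.leadingCoeff : ℚ) ≠ 0 := by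
    exact_mod_cast leadingCoeff_ne_zero.mpr (ne_zero_of_fact_irreducible g)
  have hy : AdjoinRoot.root (g.map (algebraMap ℤ ℚ)) =
      (g.leadingCoeff : ℚ)⁻¹ • (scaledRoot g : RootField g) := by
    rw [Algebra.smul_def, eq_ratCast, scaledRoot_coe, ← mul_assoc,
      ← Rat.cast_intCast (α := RootField g), ← Rat.cast_mul, inv_mul_cancel₀ ha, Rat.cast_one,
      one_mul]
  rw [hy]
  exact Subalgebra.smul_mem _ (Algebra.self_mem_adjoin_singleton ℚ _) _

/-- The power basis of `K_g/ℚ` generated by `θ`. [folklore] -/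
def scaledRootPB : PowerBasis ℚ (RootField g) :=
  PowerBasis.ofAdjoinEqTop ((RingOfIntegers.isIntegral_coe (scaledRoot g)).tower_top)
    (adjoin_scaledRoot_eq_top g)

/-- Its generator is `θ`. [folklore] -/
theorem scaledRootPB_gen : (scaledRootPB g).gen = (scaledRoot g : RootField g) :=
  PowerBasis.ofAdjoinEqTop_gen _ _

/-- Its dimension is `d = deg g`. [folklore] -/
theorem scaledRootPB_dim : (scaledRootPB g).dim = g.natDegree := by
  rw [← finrank_rootField g, PowerBasis.finrank (scaledRootPB g)]

/-- **`minpoly_ℤ θ = integralNormalization g`** (both monic of degree `d`, and the former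
divides the latter). [folklore] -/
theorem minpoly_scaledRoot : minpoly ℤ (scaledRoot g) = integralNormalization g := by
  have hint : IsIntegral ℤ (scaledRoot g : RootField g) := RingOfIntegers.isIntegral_coe _
  symm
  refine eq_of_monic_of_dvd_of_natDegree_le (minpoly.monic (RingOfIntegers.isIntegral _))
    (monic_integralNormalization (ne_zero_of_fact_irreducible g)) ?_ ?_
  · rw [← RingOfIntegers.minpoly_coe]
    exact minpoly.isIntegrallyClosed_dvd hint (aeval_scaledRoot_integralNormalization g)
  · have h1 : (minpoly ℚ (scaledRoot g : RootField g)).natDegree = g.natDegree := by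
      rw [← scaledRootPB_dim g]
      rfl
    rw [natDegree_integralNormalization, ← RingOfIntegers.minpoly_coe, ← h1,
      minpoly.isIntegrallyClosed_eq_field_fractions' ℚ hint,
      natDegree_map_eq_of_injective (algebraMap ℤ ℚ).injective_int]
    exact le_rfl

/-- `disc(1, θ, …, θ^{d-1}) = g_d^{d(d-1)} · disc(1, y, …, y^{d-1})`. [folklore] -/
theorem discr_scaledRootPB :
    Algebra.discr ℚ (scaledRootPB g).basis =
      (g.leadingCoeff : ℚ) ^ (g.natDegree * (g.natDegree - 1)) * Algebra.discr ℚ (powFamily g) := by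
  classical
  have hfam : ⇑(scaledRootPB g).basis ∘ ⇑(finCongr (scaledRootPB_dim g)).symm =
      ((Matrix.diagonal fun j : Fin g.natDegree => (g.leadingCoeff : ℚ) ^ (j : ℕ)).map
        (algebraMap ℚ (RootField g))).mulVec (powFamily g) := by
    funext j
    rw [Matrix.diagonal_map (map_zero _), Matrix.mulVec_diagonal]
    simp only [Function.comp_apply, PowerBasis.basis_eq_pow, scaledRootPB_gen, scaledRoot_coe,
      finCongr_symm, finCongr_apply, Fin.val_cast, powFamily, mul_pow, map_pow]
    congr 1
  have hsum : (∑ i : Fin g.natDegree, (i : ℕ)) * 2 = g.natDegree * (g.natDegree - 1) := by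
    rw [Fin.sum_univ_eq_sum_range (fun i => i), Finset.sum_range_id_mul_two]
  rw [← Algebra.discr_reindex ℚ (scaledRootPB g).basis (finCongr (scaledRootPB_dim g)), hfam,
    Algebra.discr_of_matrix_mulVec, Matrix.det_diagonal, Finset.prod_pow_eq_pow_sum, ← pow_mul,
    hsum]

/-- **The exponent of `ℤ[α]` divides the discriminant of the power basis of `α`**: if
`K = ℚ(α)` with `α ∈ 𝓞 K` and `D ∈ ℤ` is the discriminant of `(1, α, …, α^{d-1})`, then
`RingOfIntegers.exponent α ∣ |D|` (the discriminant lies in the conductor, Mathlib's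
`Algebra.discr_mul_isIntegral_mem_adjoin`; the exponent generates `conductor ∩ ℤ`). Quantitative
form of `exponent_pos_of_powerBasis` (`DegreeOnePrimes.lean`). [folklore] -/
theorem exponent_dvd_natAbs_of_powerBasis {L : Type*} [Field L] [NumberField L]
    (pb : PowerBasis ℚ L) {α : 𝓞 L} (hα : pb.gen = α) {D : ℤ}
    (hD : algebraMap ℤ ℚ D = Algebra.discr ℚ pb.basis) :
    RingOfIntegers.exponent α ∣ D.natAbs := by
  classical
  have hint : IsIntegral ℤ pb.gen := hα ▸ RingOfIntegers.isIntegral_coe α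
  have hmemD : ((D : ℤ) : 𝓞 L) ∈ conductor ℤ α := by
    rw [mem_conductor_iff]
    intro b
    have h := Algebra.discr_mul_isIntegral_mem_adjoin ℚ hint (RingOfIntegers.isIntegral_coe b)
    rw [← hD, hα, Algebra.smul_def, ← IsScalarTower.algebraMap_apply ℤ ℚ L, eq_intCast] at h
    refine mem_adjoin_of_coe_mem_adjoin ?_
    show algebraMap (𝓞 L) L (↑D * b) ∈ Algebra.adjoin ℤ {(α : L)}
    rw [map_mul, map_intCast]
    exact h
  have hmem : (D : ℤ) ∈ (conductor ℤ α).under ℤ := by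
    rw [Ideal.under_def, Ideal.mem_comap, algebraMap_int_eq, eq_intCast]
    exact hmemD
  rw [← Int.ideal_span_absNorm_eq_self ((conductor ℤ α).under ℤ), Ideal.mem_span_singleton] at hmem
  exact Int.natCast_dvd.mp hmem

/-- **The primes not dividing `g_d · D_g` do not divide the exponent of `θ`**, so that the
Dedekind–Kummer theorem applies to them: `exponent θ ∣ disc(1, θ, …, θ^{d-1})` and
`disc(1, θ, …) · g_d^{2d} = D_g · g_d^{d(d-1)}` in `ℤ`. [folklore] -/
theorem not_dvd_exponent_scaledRoot {p : ℕ} (hp : p.Prime)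
    (hpa : ¬ p ∣ g.leadingCoeff.natAbs) (hpD : ¬ p ∣ (tailDiscr g).natAbs) :
    ¬ p ∣ RingOfIntegers.exponent (scaledRoot g) := by
  classical
  -- the discriminant of the power basis of `θ` is an integer `Dθ`
  obtain ⟨Dθ, hDθ⟩ : ∃ Dθ : ℤ, algebraMap ℤ ℚ Dθ = Algebra.discr ℚ (scaledRootPB g).basis := by
    refine IsIntegrallyClosed.isIntegral_iff.mp (Algebra.discr_isIntegral ℚ fun i => ?_)
    rw [PowerBasis.basis_eq_pow, scaledRootPB_gen]
    exact (RingOfIntegers.isIntegral_coe _).pow _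
  have hdvd := exponent_dvd_natAbs_of_powerBasis (scaledRootPB g) (scaledRootPB_gen g) hDθ
  -- `Dθ · g_d^{2d} = D_g · g_d^{d(d-1)}`
  have hrel : Dθ * g.leadingCoeff ^ (2 * g.natDegree) =
      tailDiscr g * g.leadingCoeff ^ (g.natDegree * (g.natDegree - 1)) := by
    have h : (Dθ : ℚ) * (g.leadingCoeff : ℚ) ^ (2 * g.natDegree) =
        (tailDiscr g : ℚ) * (g.leadingCoeff : ℚ) ^ (g.natDegree * (g.natDegree - 1)) := by
      rw [cast_tailDiscr, discr_tailFamily, ← eq_intCast (algebraMap ℤ ℚ), hDθ,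
        discr_scaledRootPB]
      ring
    exact_mod_cast h
  intro hpe
  have h1 : p ∣ (Dθ * g.leadingCoeff ^ (2 * g.natDegree)).natAbs := by
    rw [Int.natAbs_mul]
    exact dvd_mul_of_dvd_left (hdvd |> (dvd_trans hpe)) _
  rw [hrel, Int.natAbs_mul, Int.natAbs_pow, hp.dvd_mul] at h1
  rcases h1 with h1 | h1
  · exact hpD h1
  · exact hpa (hp.dvd_of_dvd_pow h1)

/-- **Roots of `integralNormalization g` modulo `p` correspond to roots of `g` modulo `p`**
for `p ∤ g_d`, through `z ↦ g_d z` (`intNorm(g)(g_d z) = g_d^{d-1} g(z)`). [folklore] -/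
theorem card_roots_toFinset_integralNormalization_map {p : ℕ} [Fact p.Prime]
    (hpa : ¬ p ∣ g.leadingCoeff.natAbs) :
    ((integralNormalization g).map (Int.castRingHom (ZMod p))).roots.toFinset.card =
      (g.map (Int.castRingHom (ZMod p))).roots.toFinset.card := by
  classical
  set φ := Int.castRingHom (ZMod p)
  have ha : φ g.leadingCoeff ≠ 0 := by
    intro h
    apply hpa
    rw [← Int.natCast_dvd]
    exact (ZMod.intCast_zmod_eq_zero_iff_dvd _ p).mp h
  have hd : 1 ≤ g.natDegree := rootField_natDegree_pos g
  have hN0 : (integralNormalization g).map φ ≠ 0 :=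
    (monic_integralNormalization (ne_zero_of_fact_irreducible g)).map φ |>.ne_zero
  have hg0 : g.map φ ≠ 0 := by
    intro h
    apply ha
    have := congrArg (fun q => q.coeff g.natDegree) h
    simpa [coeff_map] using this
  have key : ∀ z : ZMod p, ((integralNormalization g).map φ).eval (φ g.leadingCoeff * z) =
      φ g.leadingCoeff ^ (g.natDegree - 1) * (g.map φ).eval z := by
    intro z
    rw [eval_map, eval_map, integralNormalization_eval₂_leadingCoeff_mul hd]
  have himage : ((integralNormalization g).map φ).roots.toFinset =
      ((g.map φ).roots.toFinset).image fun z => φ g.leadingCoeff * z := by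
    ext w
    simp only [Multiset.mem_toFinset, mem_roots hN0, mem_roots hg0, Finset.mem_image, IsRoot.def]
    constructor
    · intro hw
      refine ⟨(φ g.leadingCoeff)⁻¹ * w, ?_, by rw [← mul_assoc, mul_inv_cancel₀ ha, one_mul]⟩
      have h := key ((φ g.leadingCoeff)⁻¹ * w)
      rw [← mul_assoc, mul_inv_cancel₀ ha, one_mul, hw] at h
      exact (mul_eq_zero.mp h.symm).resolve_left (pow_ne_zero _ ha)
    · rintro ⟨z, hz, rfl⟩
      rw [key, hz, mul_zero]
  rw [himage, Finset.card_image_of_injective _ (mul_right_injective₀ ha)]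

/-- **Dedekind–Kummer for `K_g`, quantitative in the exceptional primes**: for every prime `p`
not dividing `g_d · D_g`, the number of ideals of `𝓞 K_g` of norm `p` (degree-one primes above `p`)
equals the number of roots of `g` modulo `p` (Bürgisser 2000 TCS, §4.2: "there is a bijection
between the irreducible factors of `g` modulo `p` and the primes of `K` lying over `p`, provided
`p` is not a divisor of the discriminant … the roots of `g` modulo `p` correspond to the primes of
degree one"; here with `g_d D_g` for the discriminant, which also covers non-monic `g`).
[cite: Burgisser2000TCS, §4.2 p. 83] -/
theorem idealNormCount_rootField_eq_card_roots {p : ℕ} [hp : Fact p.Prime]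
    (hpa : ¬ p ∣ g.leadingCoeff.natAbs) (hpD : ¬ p ∣ (tailDiscr g).natAbs) :
    idealNormCount (RootField g) p = (g.map (Int.castRingHom (ZMod p))).roots.toFinset.card := by
  rw [idealNormCount_def,
    card_absNorm_eq_prime_eq_card_roots (not_dvd_exponent_scaledRoot g hp.out hpa hpD),
    minpoly_scaledRoot, card_roots_toFinset_integralNormalization_map g hpa]

end ScaledRoot

end DegreeOnePrimes

end Literature.NumberTheory.LFunctions
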